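import Mathlib
import HarnessLib
import Literature.Analysis.FluidPDE.ClassicalSolution
import Literature.Analysis.FluidPDE.LerayHopf
import Literature.Analysis.FluidPDE.LerayHopfProofs
import Summits.NavierStokesRegularity.NavierStokesRegularity.Theses.QuarterJolt
import Summits.NavierStokesRegularity.NavierStokesRegularity.Theorems.QuarterJoltRung
import Summits.NavierStokesRegularity.NavierStokesRegularity.Theorems.QuarterJoltRateCaricature
import Summits.NavierStokesRegularity.NavierStokesRegularity.Theorems.CertifiedBlowupCertifiedBlowupAxisymBlowupEnergyDrain

/-!
# Route QuarterJolt — crux `NoTerminalJolt` (stmt-NavierStokesRegularity-26463), LEAD line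
# `regular_split`: the ENERGY-JUMP LAW — the `α = 0` member of the jolt family

Seat ns-ntj-p1 g3 (LEAD of the crux; `--supports 26463 --as helper`). The crux asks, in the frame
(classical on `[0,T)`, Leray–Hopf on `[0,T]`, rapidly decaying datum), that the jolt functional
`D(t) = (√(T−t))⁻¹ ∫‖u(t) − u(T)‖²` tend to `0` as `t ↑ T`, i.e. `‖u(t) − u(T)‖₂ = o((T−t)^{1/4})`. The
refuter's statement audit (refuter1-g10, K-79) and the director (KEY-NS #102 (2)) observed that,
carrying no Type-I hypothesis, the crux ALSO asserts the energy equality at `T` (no energy jump at a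
first blow-up time — known in print only under Type-I-in-time or `L^qL^p` hypotheses, Leslie–Shvydkoy,
ARMA 230 (2018), Thm. 1.2). This file makes that remark a kernel-checked LAW of the Leray–Hopf class:

* `integral_norm_sub_sq_terminal_eq` — the ENERGY-JUMP IDENTITY: for `t ∈ [0,T]`,
  `∫‖u(t) − u(T)‖² = (∫‖u(t)‖² − ∫‖u(T)‖²) + 2(∫‖u(T)‖² − ∫⟪u(t), u(T)⟫)`, and the last bracket tends to
  `0` as `t ↑ T` by the weak `L²`-continuity of the Leray–Hopf structure at `T`
  (`tendsto_integral_inner_terminal`, `tendsto_integral_norm_sub_sq_sub_energyDrop`);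
* `exists_energyJump` — THE ENERGY-JUMP LAW: for a classical Leray–Hopf solution on `[0,T)` (no decay
  needed) the energy `t ↦ ∫‖u(t)‖²` is antitone on `[0,T]` (tree theorem
  `EnergyDrain.kineticEnergy_antitoneOn`), so it has a left limit `E⁻ ≥ ∫‖u(T)‖²` at `T`, and the
  squared distance to the terminal value CONVERGES: `∫‖u(t) − u(T)‖² → J := E⁻ − ∫‖u(T)‖² ≥ 0`;
* `tendsto_integral_norm_sub_sq_of_tendsto_joltFunctional` — no terminal jolt ⇒ `J = 0`
  (`∫‖u(t) − u(T)‖² = √(T−t) · D(t) → 0`), i.e. STRONG `L²`-continuity into `T`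
  (`tendsto_eLpNorm_sub_of_tendsto_joltFunctional`) and continuity of the energy at `T`
  (`tendsto_integral_norm_sq_of_tendsto_joltFunctional`) — the `α = 0` member of the family
  `‖u(t) − u(T)‖₂ = O((T−t)^α)` whose `α > 1/4` members the crux asserts;
* `tendsto_joltFunctional_atTop_of_energyJump` — conversely an energy jump `J > 0` is a jolt of
  INFINITE strength: `D(t) → +∞`;
* `tendsto_integral_norm_sq_ssCaricature` — calibration: the self-similar caricature of the route's
  rung (`QuarterJoltRung`, p611876) has NO energy jump (`∫‖u(t)‖² = √(T−t)∫‖U‖² → 0 = ∫‖u(T)‖²`) and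
  yet JOLTS (`ssCaricature_jolts`): continuity of the energy at `T` does not see the rate, so the
  crux is STRICTLY stronger than the energy equality at `T` already in the caricature family.

The by-name consequences (crux ⇒ energy equality at every time of the frame ⇒ stmt-18118
`HodographBetchov.NoFastEnergyConcentration`) are in the companion file
`QuarterJoltEnergyJumpPosition.lean`.

HONEST FRAMING: a priori laws of the Leray–Hopf class and implications between OPEN statements;
nothing here proves `NoTerminalJolt`, the energy equality at a first blow-up time, or Navier–Stokes
regularity, all OPEN. No summit statement is proved here. [folklore]

## References
* T. M. Leslie, R. Shvydkoy, *The energy measure for the Euler and Navier–Stokes equations*, ARMA 230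
  (2018), Thm. 1.2 (arXiv:1705.04420). [LeslieShvydkoy2017]
* J. Leray, Acta Math. 63 (1934), §31 (5.1)–(5.2) (energy inequality, weak continuity). [Leray1934]
-/

noncomputable section

-- the summit and its single sub-problem share the name (CONVENTIONS §1), as in every Theorems file
set_option linter.dupNamespace false

namespace Summit.NavierStokesRegularity.NavierStokesRegularity.Theorems

open MeasureTheory Set Function Filter Topology
open scoped NNReal ENNReal InnerProductSpace RealInnerProductSpace
open Literature.Analysis.FluidPDE

namespace NoTerminalJolt

/-! ### `L²` algebra -/

/-- `∫‖f − g‖² = ∫‖f‖² + ∫‖g‖² − 2∫⟪f, g⟫` for two `L²` fields. [folklore] -/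
theorem integral_norm_sub_sq_eq {f g : EuclideanSpace ℝ (Fin 3) → EuclideanSpace ℝ (Fin 3)}
    (hf : MemLp f 2 volume) (hg : MemLp g 2 volume) :
    ∫ x, ‖f x - g x‖ ^ 2 = (∫ x, ‖f x‖ ^ 2) + (∫ x, ‖g x‖ ^ 2) - 2 * ∫ x, ⟪f x, g x⟫ := by
  have i1 : Integrable (fun x => ‖f x‖ ^ 2) volume := hf.integrable_norm_pow two_ne_zero
  have i2 : Integrable (fun x => ‖g x‖ ^ 2) volume := hg.integrable_norm_pow two_ne_zero
  have i3 : Integrable (fun x => ⟪f x, g x⟫) volume := integrable_inner_of_memLp_two hf hg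
  have hpt : (fun x => ‖f x - g x‖ ^ 2) = fun x => (‖f x‖ ^ 2 + ‖g x‖ ^ 2) - 2 * ⟪f x, g x⟫ := by
    funext x
    rw [@norm_sub_sq_real]
    ring
  have i12 : Integrable (fun x => ‖f x‖ ^ 2 + ‖g x‖ ^ 2) volume := i1.add i2
  rw [hpt, integral_sub i12 (i3.const_mul 2), integral_add i1 i2, integral_const_mul]

/-- For an `L²` field, `‖f‖_{L²} = ofReal (√(∫‖f‖²))`. [folklore] -/
theorem eLpNorm_two_eq_ofReal_sqrt {f : EuclideanSpace ℝ (Fin 3) → EuclideanSpace ℝ (Fin 3)}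
    (hf : MemLp f 2 volume) :
    eLpNorm f 2 volume = ENNReal.ofReal (Real.sqrt (∫ x, ‖f x‖ ^ 2)) := by
  rw [hf.eLpNorm_eq_integral_rpow_norm two_ne_zero ENNReal.ofNat_ne_top, Real.sqrt_eq_rpow]
  congr 1
  simp [one_div]

/-! ### The filter at `T⁻` -/

/-- `√(T − t) → 0` as `t ↑ T`. [folklore] -/
theorem tendsto_sqrt_sub_nhdsLT (T : ℝ) :
    Tendsto (fun t : ℝ => Real.sqrt (T - t)) (𝓝[<] T) (𝓝 0) := by
  have h : Tendsto (fun t : ℝ => Real.sqrt (T - t)) (𝓝 T) (𝓝 (Real.sqrt (T - T))) :=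
    ((continuous_const.sub continuous_id).sqrt).tendsto T
  rw [sub_self, Real.sqrt_zero] at h
  exact h.mono_left nhdsWithin_le_nhds

/-- `(√(T − t))⁻¹ → +∞` as `t ↑ T`. [folklore] -/
theorem tendsto_inv_sqrt_sub_nhdsLT (T : ℝ) :
    Tendsto (fun t : ℝ => (Real.sqrt (T - t))⁻¹) (𝓝[<] T) atTop := by
  refine tendsto_inv_nhdsGT_zero.comp ?_
  refine tendsto_nhdsWithin_iff.2 ⟨tendsto_sqrt_sub_nhdsLT T, ?_⟩
  filter_upwards [self_mem_nhdsWithin] with t ht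
  exact Real.sqrt_pos.2 (sub_pos.2 ht)

/-! ### The energy-jump identity (Leray–Hopf class; weak continuity at `T`) -/

/-- In the Leray–Hopf class the pairing against the terminal value is continuous from the left at
`T`: `∫⟪u(t), u(T)⟫ → ∫‖u(T)‖²` as `t ↑ T` (field `weak_continuous` with `w = u(T) ∈ L²`). [folklore] -/
theorem tendsto_integral_inner_terminal {ν T : ℝ} (hT : 0 < T)
    {f : ℝ → EuclideanSpace ℝ (Fin 3) → EuclideanSpace ℝ (Fin 3)}
    {u₀ : EuclideanSpace ℝ (Fin 3) → EuclideanSpace ℝ (Fin 3)}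
    {u : ℝ → EuclideanSpace ℝ (Fin 3) → EuclideanSpace ℝ (Fin 3)} (hLH : IsLerayHopfOn T ν f u₀ u) :
    Tendsto (fun t => ∫ x, ⟪u t x, u T x⟫) (𝓝[<] T) (𝓝 (∫ x, ‖u T x‖ ^ 2)) := by
  have hmT : MemLp (u T) 2 volume := hLH.memLp T ⟨hT.le, le_rfl⟩
  have hle_filter : 𝓝[<] T ≤ 𝓝[Ioc 0 T] T := by
    rw [← nhdsWithin_Ioo_eq_nhdsLT hT]
    exact nhdsWithin_mono _ Ioo_subset_Ioc_self
  have hlim : Tendsto (fun s => ∫ x, ⟪u s x, u T x⟫) (𝓝[<] T) (𝓝 (∫ x, ⟪u T x, u T x⟫)) :=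
    (((hLH.weak_continuous (u T) hmT).1) T ⟨hT, le_rfl⟩).tendsto.mono_left hle_filter
  have heq : ∫ x, ⟪u T x, u T x⟫ = ∫ x, ‖u T x‖ ^ 2 :=
    integral_congr_ae (Eventually.of_forall fun x => real_inner_self_eq_norm_sq _)
  rwa [heq] at hlim

/-- **The energy-jump identity.** For a Leray–Hopf solution on `[0,T]` and `t ∈ [0,T]`:
`∫‖u(t) − u(T)‖² = (∫‖u(t)‖² − ∫‖u(T)‖²) + 2(∫‖u(T)‖² − ∫⟪u(t), u(T)⟫)`. [folklore] -/
theorem integral_norm_sub_sq_terminal_eq {ν T : ℝ} (hT : 0 < T)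
    {f : ℝ → EuclideanSpace ℝ (Fin 3) → EuclideanSpace ℝ (Fin 3)}
    {u₀ : EuclideanSpace ℝ (Fin 3) → EuclideanSpace ℝ (Fin 3)}
    {u : ℝ → EuclideanSpace ℝ (Fin 3) → EuclideanSpace ℝ (Fin 3)} (hLH : IsLerayHopfOn T ν f u₀ u)
    {t : ℝ} (ht : t ∈ Icc 0 T) :
    ∫ x, ‖u t x - u T x‖ ^ 2 =
      ((∫ x, ‖u t x‖ ^ 2) - ∫ x, ‖u T x‖ ^ 2) +
        2 * ((∫ x, ‖u T x‖ ^ 2) - ∫ x, ⟪u t x, u T x⟫) := by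
  rw [integral_norm_sub_sq_eq (hLH.memLp t ht) (hLH.memLp T ⟨hT.le, le_rfl⟩)]
  ring

/-- **The energy-jump identity, limit form.** For a Leray–Hopf solution on `[0,T]` the squared `L²`
distance to the terminal value and the energy drop differ by `o(1)` as `t ↑ T`:
`∫‖u(t) − u(T)‖² − (∫‖u(t)‖² − ∫‖u(T)‖²) → 0`. [folklore] -/
theorem tendsto_integral_norm_sub_sq_sub_energyDrop {ν T : ℝ} (hT : 0 < T)
    {f : ℝ → EuclideanSpace ℝ (Fin 3) → EuclideanSpace ℝ (Fin 3)}
    {u₀ : EuclideanSpace ℝ (Fin 3) → EuclideanSpace ℝ (Fin 3)}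
    {u : ℝ → EuclideanSpace ℝ (Fin 3) → EuclideanSpace ℝ (Fin 3)} (hLH : IsLerayHopfOn T ν f u₀ u) :
    Tendsto (fun t => (∫ x, ‖u t x - u T x‖ ^ 2) - ((∫ x, ‖u t x‖ ^ 2) - ∫ x, ‖u T x‖ ^ 2))
      (𝓝[<] T) (𝓝 0) := by
  have hev : (fun t => (∫ x, ‖u t x - u T x‖ ^ 2) - ((∫ x, ‖u t x‖ ^ 2) - ∫ x, ‖u T x‖ ^ 2))
      =ᶠ[𝓝[<] T] fun t => 2 * ((∫ x, ‖u T x‖ ^ 2) - ∫ x, ⟪u t x, u T x⟫) := by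
    filter_upwards [Ioo_mem_nhdsLT hT] with t ht
    rw [integral_norm_sub_sq_terminal_eq hT hLH ⟨ht.1.le, ht.2.le⟩]
    ring
  refine Tendsto.congr' hev.symm ?_
  have h2 := ((tendsto_const_nhds (x := ∫ x, ‖u T x‖ ^ 2)).sub
    (tendsto_integral_inner_terminal hT hLH)).const_mul 2
  simpa using h2

/-- **Radon–Riesz in the Leray–Hopf class.** For a Leray–Hopf solution on `[0,T]`, the energy is
continuous from the left at `T` (`∫‖u(t)‖² → ∫‖u(T)‖²`) iff the trajectory is strongly `L²`-continuous
into `T` (`∫‖u(t) − u(T)‖² → 0`). [folklore] -/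
theorem tendsto_integral_norm_sq_iff_tendsto_integral_norm_sub_sq {ν T : ℝ} (hT : 0 < T)
    {f : ℝ → EuclideanSpace ℝ (Fin 3) → EuclideanSpace ℝ (Fin 3)}
    {u₀ : EuclideanSpace ℝ (Fin 3) → EuclideanSpace ℝ (Fin 3)}
    {u : ℝ → EuclideanSpace ℝ (Fin 3) → EuclideanSpace ℝ (Fin 3)} (hLH : IsLerayHopfOn T ν f u₀ u) :
    Tendsto (fun t => ∫ x, ‖u t x‖ ^ 2) (𝓝[<] T) (𝓝 (∫ x, ‖u T x‖ ^ 2)) ↔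
      Tendsto (fun t => ∫ x, ‖u t x - u T x‖ ^ 2) (𝓝[<] T) (𝓝 0) := by
  have hd := tendsto_integral_norm_sub_sq_sub_energyDrop hT hLH
  constructor
  · intro h
    have h1 : Tendsto (fun t => (∫ x, ‖u t x‖ ^ 2) - ∫ x, ‖u T x‖ ^ 2) (𝓝[<] T) (𝓝 0) := by
      have h' := h.sub_const (∫ x, ‖u T x‖ ^ 2)
      rwa [sub_self] at h'
    have h2 := hd.add h1
    simp only [sub_add_cancel, add_zero] at h2
    exact h2
  · intro h
    have h1 := h.sub hd
    simp only [sub_sub_cancel, zero_sub] at h1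
    have h2 := h1.add (tendsto_const_nhds (x := ∫ x, ‖u T x‖ ^ 2))
    simp only [sub_add_cancel] at h2
    simpa using h2

/-- For `L²` slices, `‖u(t) − u(T)‖_{L²} → 0` iff `∫‖u(t) − u(T)‖² → 0` as `t ↑ T`. [folklore] -/
theorem tendsto_eLpNorm_sub_iff_tendsto_integral_norm_sub_sq {ν T : ℝ} (hT : 0 < T)
    {f : ℝ → EuclideanSpace ℝ (Fin 3) → EuclideanSpace ℝ (Fin 3)}
    {u₀ : EuclideanSpace ℝ (Fin 3) → EuclideanSpace ℝ (Fin 3)}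
    {u : ℝ → EuclideanSpace ℝ (Fin 3) → EuclideanSpace ℝ (Fin 3)} (hLH : IsLerayHopfOn T ν f u₀ u) :
    Tendsto (fun t => eLpNorm (u t - u T) 2 volume) (𝓝[<] T) (𝓝 0) ↔
      Tendsto (fun t => ∫ x, ‖u t x - u T x‖ ^ 2) (𝓝[<] T) (𝓝 0) := by
  have hmT : MemLp (u T) 2 volume := hLH.memLp T ⟨hT.le, le_rfl⟩
  -- on `(0,T)` the `L²` norm of the difference is `ofReal √(∫‖u t − u T‖²)`
  have hev : (fun t => eLpNorm (u t - u T) 2 volume)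
      =ᶠ[𝓝[<] T] fun t => ENNReal.ofReal (Real.sqrt (∫ x, ‖u t x - u T x‖ ^ 2)) := by
    filter_upwards [Ioo_mem_nhdsLT hT] with t ht
    exact eLpNorm_two_eq_ofReal_sqrt ((hLH.memLp t ⟨ht.1.le, ht.2.le⟩).sub hmT)
  have hnn : ∀ t, 0 ≤ ∫ x, ‖u t x - u T x‖ ^ 2 := fun t => integral_nonneg fun _ => sq_nonneg _
  constructor
  · intro h
    have h1 : Tendsto (fun t => ENNReal.ofReal (Real.sqrt (∫ x, ‖u t x - u T x‖ ^ 2)))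
        (𝓝[<] T) (𝓝 0) := h.congr' hev
    have h2 : Tendsto (fun t => (ENNReal.ofReal (Real.sqrt (∫ x, ‖u t x - u T x‖ ^ 2))).toReal)
        (𝓝[<] T) (𝓝 (0 : ℝ≥0∞).toReal) := (ENNReal.tendsto_toReal ENNReal.zero_ne_top).comp h1
    have h3 : Tendsto (fun t => Real.sqrt (∫ x, ‖u t x - u T x‖ ^ 2)) (𝓝[<] T) (𝓝 0) := by
      refine (h2.congr fun t => ?_).trans (by simp)
      exact ENNReal.toReal_ofReal (Real.sqrt_nonneg _)
    have h4 := h3.mul h3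
    simp only [mul_zero] at h4
    refine h4.congr fun t => ?_
    rw [← sq, Real.sq_sqrt (hnn t)]
  · intro h
    refine Tendsto.congr' hev.symm ?_
    have h1 : Tendsto (fun t => Real.sqrt (∫ x, ‖u t x - u T x‖ ^ 2)) (𝓝[<] T) (𝓝 0) := by
      simpa using h.sqrt
    simpa using ENNReal.tendsto_ofReal h1

/-! ### No terminal jolt ⇒ no energy jump (the `α = 0` member) -/

/-- **No terminal jolt ⇒ strong `L²` approach** (frame-free): if `(√(T−t))⁻¹ ∫‖u(t) − u(T)‖² → 0`
as `t ↑ T`, then `∫‖u(t) − u(T)‖² = √(T−t) · D(t) → 0`. [folklore] -/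
theorem tendsto_integral_norm_sub_sq_of_tendsto_joltFunctional {T : ℝ}
    {u : ℝ → EuclideanSpace ℝ (Fin 3) → EuclideanSpace ℝ (Fin 3)}
    (hJ : Tendsto (fun t : ℝ => (Real.sqrt (T - t))⁻¹ * ∫ x, ‖u t x - u T x‖ ^ 2)
      (𝓝[<] T) (𝓝 0)) :
    Tendsto (fun t : ℝ => ∫ x, ‖u t x - u T x‖ ^ 2) (𝓝[<] T) (𝓝 0) := by
  have hev : (fun t : ℝ => ∫ x, ‖u t x - u T x‖ ^ 2) =ᶠ[𝓝[<] T]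
      fun t => Real.sqrt (T - t) * ((Real.sqrt (T - t))⁻¹ * ∫ x, ‖u t x - u T x‖ ^ 2) := by
    filter_upwards [self_mem_nhdsWithin] with t ht
    have hpos : 0 < Real.sqrt (T - t) := Real.sqrt_pos.2 (sub_pos.2 ht)
    rw [← mul_assoc, mul_inv_cancel₀ hpos.ne', one_mul]
  refine Tendsto.congr' hev.symm ?_
  simpa using (tendsto_sqrt_sub_nhdsLT T).mul hJ

/-- **No terminal jolt ⇒ strong `L²`-continuity into `T`** (Leray–Hopf class, `eLpNorm` form — the
hypothesis of `FastClassSqueeze.Birth.stub_no_fast_energy_concentration_of_tendsto`). [folklore] -/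
theorem tendsto_eLpNorm_sub_of_tendsto_joltFunctional {ν T : ℝ} (hT : 0 < T)
    {f : ℝ → EuclideanSpace ℝ (Fin 3) → EuclideanSpace ℝ (Fin 3)}
    {u₀ : EuclideanSpace ℝ (Fin 3) → EuclideanSpace ℝ (Fin 3)}
    {u : ℝ → EuclideanSpace ℝ (Fin 3) → EuclideanSpace ℝ (Fin 3)} (hLH : IsLerayHopfOn T ν f u₀ u)
    (hJ : Tendsto (fun t : ℝ => (Real.sqrt (T - t))⁻¹ * ∫ x, ‖u t x - u T x‖ ^ 2)
      (𝓝[<] T) (𝓝 0)) :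
    Tendsto (fun t => eLpNorm (u t - u T) 2 volume) (𝓝[<] T) (𝓝 0) :=
  (tendsto_eLpNorm_sub_iff_tendsto_integral_norm_sub_sq hT hLH).2
    (tendsto_integral_norm_sub_sq_of_tendsto_joltFunctional hJ)

/-- **No terminal jolt ⇒ no energy jump at `T`** (energy equality at the terminal time, Leray–Hopf
class): `∫‖u(t)‖² → ∫‖u(T)‖²` as `t ↑ T`. [folklore] -/
theorem tendsto_integral_norm_sq_of_tendsto_joltFunctional {ν T : ℝ} (hT : 0 < T)
    {f : ℝ → EuclideanSpace ℝ (Fin 3) → EuclideanSpace ℝ (Fin 3)}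
    {u₀ : EuclideanSpace ℝ (Fin 3) → EuclideanSpace ℝ (Fin 3)}
    {u : ℝ → EuclideanSpace ℝ (Fin 3) → EuclideanSpace ℝ (Fin 3)} (hLH : IsLerayHopfOn T ν f u₀ u)
    (hJ : Tendsto (fun t : ℝ => (Real.sqrt (T - t))⁻¹ * ∫ x, ‖u t x - u T x‖ ^ 2)
      (𝓝[<] T) (𝓝 0)) :
    Tendsto (fun t => ∫ x, ‖u t x‖ ^ 2) (𝓝[<] T) (𝓝 (∫ x, ‖u T x‖ ^ 2)) :=
  (tendsto_integral_norm_sq_iff_tendsto_integral_norm_sub_sq hT hLH).2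
    (tendsto_integral_norm_sub_sq_of_tendsto_joltFunctional hJ)

/-! ### An energy jump is a jolt of infinite strength -/

/-- **An energy jump at `T` is a terminal jolt of infinite strength.** If, for a Leray–Hopf solution on
`[0,T]`, the energy drop to the terminal value stays `≥ J > 0` near `T`
(`J ≤ ∫‖u(t)‖² − ∫‖u(T)‖²` eventually as `t ↑ T`), then `∫‖u(t) − u(T)‖² ≥ J/2` eventually and the
jolt functional diverges: `(√(T−t))⁻¹ ∫‖u(t) − u(T)‖² → +∞`. [folklore] -/
theorem tendsto_joltFunctional_atTop_of_energyJump {ν T : ℝ} (hT : 0 < T)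
    {f : ℝ → EuclideanSpace ℝ (Fin 3) → EuclideanSpace ℝ (Fin 3)}
    {u₀ : EuclideanSpace ℝ (Fin 3) → EuclideanSpace ℝ (Fin 3)}
    {u : ℝ → EuclideanSpace ℝ (Fin 3) → EuclideanSpace ℝ (Fin 3)} (hLH : IsLerayHopfOn T ν f u₀ u)
    {J : ℝ} (hJ : 0 < J)
    (hjump : ∀ᶠ t in 𝓝[<] T, J ≤ (∫ x, ‖u t x‖ ^ 2) - ∫ x, ‖u T x‖ ^ 2) :
    Tendsto (fun t : ℝ => (Real.sqrt (T - t))⁻¹ * ∫ x, ‖u t x - u T x‖ ^ 2) (𝓝[<] T) atTop := by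
  have hd := tendsto_integral_norm_sub_sq_sub_energyDrop hT hLH
  have hev : ∀ᶠ t in 𝓝[<] T, J / 2 ≤ ∫ x, ‖u t x - u T x‖ ^ 2 := by
    have h1 : ∀ᶠ t in 𝓝[<] T, -(J / 2) <
        (∫ x, ‖u t x - u T x‖ ^ 2) - ((∫ x, ‖u t x‖ ^ 2) - ∫ x, ‖u T x‖ ^ 2) :=
      hd.eventually (Ioi_mem_nhds (by linarith))
    filter_upwards [h1, hjump] with t h1 h2
    linarith
  have hlow : Tendsto (fun t : ℝ => (J / 2) * (Real.sqrt (T - t))⁻¹) (𝓝[<] T) atTop :=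
    (tendsto_inv_sqrt_sub_nhdsLT T).const_mul_atTop (by linarith)
  refine tendsto_atTop_mono' _ ?_ hlow
  filter_upwards [hev] with t ht
  rw [mul_comm]
  exact mul_le_mul_of_nonneg_left ht (inv_nonneg.2 (Real.sqrt_nonneg _))

/-- In particular an energy jump at `T` excludes the no-terminal-jolt conclusion at `T`. [folklore] -/
theorem not_tendsto_joltFunctional_of_energyJump {ν T : ℝ} (hT : 0 < T)
    {f : ℝ → EuclideanSpace ℝ (Fin 3) → EuclideanSpace ℝ (Fin 3)}
    {u₀ : EuclideanSpace ℝ (Fin 3) → EuclideanSpace ℝ (Fin 3)}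
    {u : ℝ → EuclideanSpace ℝ (Fin 3) → EuclideanSpace ℝ (Fin 3)} (hLH : IsLerayHopfOn T ν f u₀ u)
    {J : ℝ} (hJ : 0 < J)
    (hjump : ∀ᶠ t in 𝓝[<] T, J ≤ (∫ x, ‖u t x‖ ^ 2) - ∫ x, ‖u T x‖ ^ 2) :
    ¬ Tendsto (fun t : ℝ => (Real.sqrt (T - t))⁻¹ * ∫ x, ‖u t x - u T x‖ ^ 2)
      (𝓝[<] T) (𝓝 0) :=
  not_tendsto_nhds_of_tendsto_atTop (tendsto_joltFunctional_atTop_of_energyJump hT hLH hJ hjump) 0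

/-! ### THE ENERGY-JUMP LAW (classical Leray–Hopf solutions on `[0,T)`; no decay needed) -/

/-- **THE ENERGY-JUMP LAW.** Let `(u,p)` be a classical solution of unforced Navier–Stokes on
`ℝ³ × [0,T)`, `ν > 0`, which is Leray–Hopf on `[0,T]` from `u 0` (no decay hypothesis). The energy
`t ↦ ∫‖u(t)‖²` is antitone on `[0,T]` (`EnergyDrain.kineticEnergy_antitoneOn`), so it has a left
limit `E⁻` at `T` with `E⁻ ≥ ∫‖u(T)‖²`, and the squared `L²` distance to the terminal value CONVERGES
to the ENERGY JUMP: `∫‖u(t) − u(T)‖² → J := E⁻ − ∫‖u(T)‖² ≥ 0` as `t ↑ T`, with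
`J ≤ ∫‖u(t)‖² − ∫‖u(T)‖²` for every `t ∈ [0,T)`. [folklore] -/
theorem exists_energyJump {ν T : ℝ} (hν : 0 < ν) (hT : 0 < T)
    {u : ℝ → EuclideanSpace ℝ (Fin 3) → EuclideanSpace ℝ (Fin 3)}
    {p : ℝ → EuclideanSpace ℝ (Fin 3) → ℝ}
    (hcl : IsClassicalNSSolutionOn (Ico 0 T) ν 0 u p) (hLH : IsLerayHopfOn T ν 0 (u 0) u) :
    ∃ J : ℝ, 0 ≤ J ∧
      (∀ t ∈ Ico 0 T, J ≤ (∫ x, ‖u t x‖ ^ 2) - ∫ x, ‖u T x‖ ^ 2) ∧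
      Tendsto (fun t => (∫ x, ‖u t x‖ ^ 2) - ∫ x, ‖u T x‖ ^ 2) (𝓝[<] T) (𝓝 J) ∧
      Tendsto (fun t => ∫ x, ‖u t x - u T x‖ ^ 2) (𝓝[<] T) (𝓝 J) := by
  -- the energy `e t = ∫‖u t‖²` is antitone on `[0,T]`
  have hanti : AntitoneOn (fun t => ∫ x, ‖u t x‖ ^ 2) (Icc 0 T) := by
    intro s hs t ht hst
    have h := CertifiedBlowupAxisymBlowup.EnergyDrain.kineticEnergy_antitoneOn hν hcl hLH hs ht hst
    simp only [VectorCalculus.kineticEnergy] at h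
    show ∫ x, ‖u t x‖ ^ 2 ≤ ∫ x, ‖u s x‖ ^ 2
    linarith
  -- its left limit at `T` is the infimum over `[0,T)`
  set e : ℝ → ℝ := fun t => (∫ x, ‖u t x‖ ^ 2) - ∫ x, ‖u T x‖ ^ 2 with he
  have he_nonneg : ∀ t ∈ Ico 0 T, 0 ≤ e t := fun t ht => by
    have h := hanti ⟨ht.1, ht.2.le⟩ ⟨hT.le, le_rfl⟩ ht.2.le
    simp only [he]
    linarith
  have he_anti : ∀ s ∈ Ico 0 T, ∀ t ∈ Ico 0 T, s ≤ t → e t ≤ e s := fun s hs t ht hst => by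
    have h := hanti ⟨hs.1, hs.2.le⟩ ⟨ht.1, ht.2.le⟩ hst
    simp only [he]
    linarith
  set J : ℝ := sInf (e '' Ico 0 T) with hJ
  have hne : (e '' Ico 0 T).Nonempty := ⟨e 0, 0, ⟨le_rfl, hT⟩, rfl⟩
  have hbdd : BddBelow (e '' Ico 0 T) := ⟨0, by rintro _ ⟨t, ht, rfl⟩; exact he_nonneg t ht⟩
  have hJle : ∀ t ∈ Ico 0 T, J ≤ e t := fun t ht => csInf_le hbdd ⟨t, ht, rfl⟩
  have hJ0 : 0 ≤ J := le_csInf hne (by rintro _ ⟨t, ht, rfl⟩; exact he_nonneg t ht)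
  -- `e t → J` as `t ↑ T`
  have hlim : Tendsto e (𝓝[<] T) (𝓝 J) := by
    refine tendsto_order.2 ⟨fun a ha => ?_, fun b hb => ?_⟩
    · filter_upwards [Ioo_mem_nhdsLT hT] with t ht
      exact ha.trans_le (hJle t ⟨ht.1.le, ht.2⟩)
    · obtain ⟨_, ⟨s, hs, rfl⟩, hsb⟩ := (csInf_lt_iff hbdd hne).1 hb
      filter_upwards [Ioo_mem_nhdsLT hs.2] with t ht
      exact (he_anti s hs t ⟨hs.1.trans ht.1.le, ht.2⟩ ht.1.le).trans_lt hsb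
  refine ⟨J, hJ0, hJle, hlim, ?_⟩
  have h := (tendsto_integral_norm_sub_sq_sub_energyDrop hT hLH).add hlim
  simp only [zero_add] at h
  refine h.congr fun t => ?_
  simp only [he, sub_add_cancel]

/-- **The energy-jump law, dichotomy form.** In the setting of `exists_energyJump`: EITHER the energy
is continuous at `T` (no jump: `∫‖u(t)‖² → ∫‖u(T)‖²`, equivalently `‖u(t) − u(T)‖_{L²} → 0`), OR the
jolt functional diverges, `(√(T−t))⁻¹ ∫‖u(t) − u(T)‖² → +∞`. [folklore] -/
theorem energyContinuous_or_tendsto_joltFunctional_atTop {ν T : ℝ} (hν : 0 < ν) (hT : 0 < T)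
    {u : ℝ → EuclideanSpace ℝ (Fin 3) → EuclideanSpace ℝ (Fin 3)}
    {p : ℝ → EuclideanSpace ℝ (Fin 3) → ℝ}
    (hcl : IsClassicalNSSolutionOn (Ico 0 T) ν 0 u p) (hLH : IsLerayHopfOn T ν 0 (u 0) u) :
    Tendsto (fun t => ∫ x, ‖u t x‖ ^ 2) (𝓝[<] T) (𝓝 (∫ x, ‖u T x‖ ^ 2)) ∨
      Tendsto (fun t : ℝ => (Real.sqrt (T - t))⁻¹ * ∫ x, ‖u t x - u T x‖ ^ 2) (𝓝[<] T) atTop := by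
  obtain ⟨J, hJ0, hJle, hlim, -⟩ := exists_energyJump hν hT hcl hLH
  rcases hJ0.eq_or_lt with hJ | hJ
  · left
    have h := hlim.add (tendsto_const_nhds (x := ∫ x, ‖u T x‖ ^ 2))
    rw [← hJ, zero_add] at h
    exact h.congr fun t => by simp only [sub_add_cancel]
  · right
    refine tendsto_joltFunctional_atTop_of_energyJump hT hLH hJ ?_
    filter_upwards [Ioo_mem_nhdsLT hT] with t ht
    exact hJle t ⟨ht.1.le, ht.2⟩

/-! ### Calibration: the self-similar caricature has no energy jump and yet jolts -/

/-- **Calibration.** The self-similar caricature `u(t,x) = λU(λx)`, `λ = (T−t)^{−1/2}` (extinct terminal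
value, `QuarterJoltRung.ssCaricature`) has `∫‖u(t)‖² = √(T−t) · ∫‖U‖² → 0 = ∫‖u(T)‖²`: its energy is
CONTINUOUS at `T` (no energy jump) — while it JOLTS for every profile with `∫‖U‖² ≠ 0`
(`QuarterJoltRung.ssCaricature_jolts`). So «no energy jump at `T`» is strictly weaker than «no terminal
jolt» already in the caricature family: the energy does not see the approach rate. [folklore] -/
theorem tendsto_integral_norm_sq_ssCaricature (T : ℝ)
    (U : EuclideanSpace ℝ (Fin 3) → EuclideanSpace ℝ (Fin 3)) :
    Tendsto (fun t => ∫ x, ‖QuarterJoltRung.ssCaricature T U t x‖ ^ 2) (𝓝[<] T)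
      (𝓝 (∫ x, ‖QuarterJoltRung.ssCaricature T U T x‖ ^ 2)) := by
  have hev : (fun t => ∫ x, ‖QuarterJoltRung.ssCaricature T U t x‖ ^ 2) =ᶠ[𝓝[<] T]
      fun t => Real.sqrt (T - t) * ∫ x, ‖U x‖ ^ 2 := by
    filter_upwards [self_mem_nhdsWithin] with t ht
    exact QuarterJoltRung.integral_norm_sq_ssCaricature ht U
  refine Tendsto.congr' hev.symm ?_
  simpa [QuarterJoltRung.ssCaricature_top] using (tendsto_sqrt_sub_nhdsLT T).mul_const (∫ x, ‖U x‖ ^ 2)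

end NoTerminalJolt

end Summit.NavierStokesRegularity.NavierStokesRegularity.Theorems

end
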